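import Mathlib
import HarnessLib

/-!
# Fixed-point affine arithmetic with inclusion theorems

Topic `Literature/Analysis/ValidatedNumerics`. Interval arithmetic (`FixedPointInterval.lean`,
`MultiPrecisionInterval.lean`, `MultiPrecisionBall.lean`) forgets every correlation between
sub-expressions (the *dependency problem*: `x - x` gets twice the width of `x`). AFFINE ARITHMETIC
(de Figueiredo–Stolfi) represents each quantity of a computation as an affine form
`x·S = c + Σ_j a_j ε_j + e` in NOISE SYMBOLS `ε_j ∈ [-1, 1]` *shared* by all the quantities
(typically `ε_j` is the `j`-th coordinate of a parameter box) plus an unshared error `|e| ≤ r`: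
linear operations are exact and keep all first-order correlations; only the genuinely nonlinear
part of a product (or of a reciprocal, `AffineArithmeticInv.lean`) goes into `r`. This file is a
kernel/`native_decide`-evaluable fixed-point version in the style of `MultiPrecisionBall.lean`
(whose balls `FB` are affine forms without noise symbols): `c`, `a_j`, `r` are integers at a
common scale `S` (an explicit argument of the operations that round); all operations are total
computable functions defined by structural recursion on coefficient lists (no `Finset` in
definitions), each with its inclusion theorem.

## Main definitions and results (namespace `Literature.Analysis.ValidatedNumerics`)

* `AForm = ⟨c, a, r⟩`, `AForm.lin ε a = Σ_j a_j ε_j`, `AForm.Valid ε : ∀ j, |ε j| ≤ 1`,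
  `AForm.mem S ε x F : |x·S - (c + lin ε a)| ≤ r`; constructors `const c` (`c/S`), `ofRat S q`,
  `var c w j` (the box coordinate `(c + w ε_j)/S`); exact linear operations `add`, `sub`, `neg`,
  `mulInt`, `addInt` (coefficient lists combined by the zero-padding `zipWithPad` — the truncating
  `List.zipWith` would be unsound); `absSum a = Σ_j |a_j|`, `rad F = absSum a + r`, the enclosing
  scaled interval `[lo F, hi F]`; the rounded product `mul S` and square `sq S`.
* Inclusion: `AForm.mem_const/ofRat/var/add/neg/sub/mulInt/addInt/mul/sq`, `abs_sub_le_rad`,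
  `lo_le`, `le_hi`; linear parts: `lin_eq_sum`, `lin_map`, `abs_lin_map_sub_le`, `lin_zipWithPad`,
  `abs_lin_zipWithPad_sub_le`, `abs_lin_le`, `lin_replicate_append`; rounding read in `ℝ`:
  `abs_ediv_sub_le`, `abs_floor_sub_le`, `div_le_ceilDiv`.

## References

* L. H. de Figueiredo, J. Stolfi, *Affine arithmetic: concepts and applications*, Numer.
  Algorithms 37 (2004) 147–158: §2 (affine forms, noise symbols), §3 (affine operations;
  non-affine operation = affine approximation + error term). [FigueiredoStolfi2004]
* J. Stolfi, L. H. de Figueiredo, *Self-Validated Numerical Methods and Applications*, 21st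
  Brazilian Mathematics Colloquium, IMPA (1997).

Design choice: the error of a non-affine operation is accumulated in the single radius `r`
(forms stay as long as the number of box coordinates) rather than in a fresh noise symbol.
-/

open Finset

namespace Literature.Analysis.ValidatedNumerics

/-- An affine form at scale `S`: for noise values `ε_j ∈ [-1, 1]`, `⟨c, a, r⟩` stands for the
reals `x` with `x·S = c + Σ_j a_j ε_j + e`, `|e| ≤ r` (coefficients beyond the end of `a` are
`0`). [cite: FigueiredoStolfi2004, §2] -/
structure AForm where
  /-- scaled centre -/
  c : ℤ
  /-- scaled noise coefficients, entry `j` multiplies `ε_j` -/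
  a : List ℤ
  /-- scaled radius of the unshared error term -/
  r : ℕ
  deriving DecidableEq, Repr, Inhabited

namespace AForm

/-- The `j`-th noise coefficient (`0` beyond the end of the list; cf. `lin_eq_sum`). [folklore] -/
def coeff (F : AForm) (j : ℕ) : ℤ := F.a.getD j 0

/-- The linear part `Σ_j a_j ε_j` of a coefficient list (structural recursion, shifting `ε`).
[folklore] -/
def lin : (ℕ → ℝ) → List ℤ → ℝ
  | _, [] => 0
  | ε, b :: l => b * ε 0 + lin (fun j => ε (j + 1)) l

/-- Zero-padding `zipWith`: entry `j` of `zipWithPad f l₁ l₂` is `f l₁[j] l₂[j]`, missing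
entries read as `0` (`List.zipWith` truncates to the shorter list instead). [folklore] -/
def zipWithPad (f : ℤ → ℤ → ℤ) : List ℤ → List ℤ → List ℤ
  | [], l₂ => l₂.map (f 0)
  | b :: l₁, [] => (b :: l₁).map fun u => f u 0
  | b :: l₁, d :: l₂ => f b d :: zipWithPad f l₁ l₂

/-- `Σ_j |a_j|`. [folklore] -/
def absSum : List ℤ → ℕ
  | [] => 0
  | b :: l => b.natAbs + absSum l

/-- Admissible noise values: `|ε_j| ≤ 1` for every `j`. [cite: FigueiredoStolfi2004, §2] -/
def Valid (ε : ℕ → ℝ) : Prop := ∀ j, |ε j| ≤ 1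

/-- `x ∈ F` at scale `S` for the noise values `ε`: `|x·S - (c + Σ_j a_j ε_j)| ≤ r`.
[cite: FigueiredoStolfi2004, §2] -/
def mem (S : ℕ) (ε : ℕ → ℝ) (x : ℝ) (F : AForm) : Prop := |x * S - (F.c + lin ε F.a)| ≤ F.r

/-- The exact number `c/S`. [folklore] -/
def const (c : ℤ) : AForm := ⟨c, [], 0⟩

/-- An enclosure of the rational `q` (radius one unit of the scale). [folklore] -/
def ofRat (S : ℕ) (q : ℚ) : AForm := ⟨⌊q * S⌋, [], 1⟩

/-- The `j`-th box coordinate, scaled centre `c` and half-width `w`: `x·S = c + w ε_j` exactly.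
[cite: FigueiredoStolfi2004, §2] -/
def var (c w : ℤ) (j : ℕ) : AForm := ⟨c, List.replicate j 0 ++ [w], 0⟩

/-- Sum (exact). [cite: FigueiredoStolfi2004, §3] -/
def add (F G : AForm) : AForm := ⟨F.c + G.c, zipWithPad (· + ·) F.a G.a, F.r + G.r⟩

/-- Product with the integer `k` (exact). [cite: FigueiredoStolfi2004, §3] -/
def mulInt (k : ℤ) (F : AForm) : AForm := ⟨k * F.c, F.a.map (k * ·), k.natAbs * F.r⟩

/-- Negation (exact). [cite: FigueiredoStolfi2004, §3] -/
def neg (F : AForm) : AForm := mulInt (-1) F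

/-- Difference (exact: `sub F F` has centre `0` and zero linear part). [cite: FigueiredoStolfi2004, §3] -/
def sub (F G : AForm) : AForm := add F (neg G)

/-- Translation by `k/S` (exact). [cite: FigueiredoStolfi2004, §3] -/
def addInt (k : ℤ) (F : AForm) : AForm := ⟨F.c + k, F.a, F.r⟩

/-- Total deviation `Σ_j |a_j| + r` (`|x·S - c| ≤ rad F` on the form). [cite: FigueiredoStolfi2004, §2] -/
def rad (F : AForm) : ℕ := absSum F.a + F.r

/-- Scaled lower end of the range of the form. [cite: FigueiredoStolfi2004, §2] -/
def lo (F : AForm) : ℤ := F.c - rad F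

/-- Scaled upper end of the range of the form. [cite: FigueiredoStolfi2004, §2] -/
def hi (F : AForm) : ℤ := F.c + rad F

/-- Product at scale `S`. With `x·S = c₁ + A + e₁`, `y·S = c₂ + B + e₂` (`A, B` the linear parts,
`|eᵢ| ≤ rᵢ`), `(xy)·S = [c₁c₂ + c₁B + c₂A + c₁e₂ + c₂e₁ + (A + e₁)(B + e₂)]/S`: the centre is
`⌊c₁c₂/S⌋` (error `≤ 1`), the `j`-th coefficient `⌊(c₁b_j + c₂a_j)/S⌋` (at most
`L = max |a| |b|` errors, each `≤ |ε_j| ≤ 1`), and `|c₁e₂ + c₂e₁ + (A + e₁)(B + e₂)| ≤ p :=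
|c₁|r₂ + |c₂|r₁ + rad F · rad G` (by `|A| ≤ Σ|a_j|`); radius `⌈p/S⌉ + 1 + L`.
[cite: FigueiredoStolfi2004, §3] -/
def mul (S : ℕ) (F G : AForm) : AForm :=
  ⟨F.c * G.c / S, zipWithPad (fun u v => (F.c * v + G.c * u) / S) F.a G.a,
    (F.c.natAbs * G.r + G.c.natAbs * F.r + rad F * rad G + S - 1) / S + 1 +
      max F.a.length G.a.length⟩

/-- Square at scale `S`. [cite: FigueiredoStolfi2004, §3] -/
def sq (S : ℕ) (F : AForm) : AForm := mul S F F

variable {S : ℕ} {ε : ℕ → ℝ} {x y : ℝ} {F G : AForm}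

/-! ### The linear part -/

/-- [folklore] -/
@[simp] theorem lin_nil (ε : ℕ → ℝ) : lin ε [] = 0 := rfl

/-- [folklore] -/
@[simp] theorem lin_cons (ε : ℕ → ℝ) (b : ℤ) (l : List ℤ) :
    lin ε (b :: l) = b * ε 0 + lin (fun j => ε (j + 1)) l := rfl

/-- [folklore] -/
@[simp] theorem absSum_cons (b : ℤ) (l : List ℤ) : absSum (b :: l) = b.natAbs + absSum l := rfl

/-- [folklore] -/
@[simp] theorem zipWithPad_nil (f : ℤ → ℤ → ℤ) (l₂ : List ℤ) :
    zipWithPad f [] l₂ = l₂.map (f 0) := rfl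

/-- [folklore] -/
@[simp] theorem zipWithPad_cons_nil (f : ℤ → ℤ → ℤ) (b : ℤ) (l₁ : List ℤ) :
    zipWithPad f (b :: l₁) [] = (b :: l₁).map fun u => f u 0 := rfl

/-- [folklore] -/
@[simp] theorem zipWithPad_cons_cons (f : ℤ → ℤ → ℤ) (b d : ℤ) (l₁ l₂ : List ℤ) :
    zipWithPad f (b :: l₁) (d :: l₂) = f b d :: zipWithPad f l₁ l₂ := rfl

/-- Validity is preserved by the index shift of the recursion. [folklore] -/
theorem Valid.tail (hε : Valid ε) : Valid fun j => ε (j + 1) := fun j => hε (j + 1)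

/-- `lin ε l = Σ_{j < |l|} l[j] ε_j`. [folklore] -/
theorem lin_eq_sum (ε : ℕ → ℝ) (l : List ℤ) :
    lin ε l = ∑ j ∈ range l.length, (l.getD j 0 : ℝ) * ε j := by
  induction l generalizing ε with
  | nil => simp
  | cons b l ih => rw [lin_cons, ih, List.length_cons, sum_range_succ', add_comm]; simp

/-- An exactly `t`-linear map of the coefficients multiplies the linear part by `t`. [folklore] -/
theorem lin_map {g : ℤ → ℤ} {t : ℝ} (hg : ∀ b, (g b : ℝ) = t * b) (ε : ℕ → ℝ) (l : List ℤ) :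
    lin ε (l.map g) = t * lin ε l := by
  induction l generalizing ε with
  | nil => simp
  | cons b l ih => rw [List.map_cons, lin_cons, lin_cons, ih, hg]; ring

/-- One rounding step: `|d| ≤ 1 → |η| ≤ 1 → |R| ≤ n → |d·η + R| ≤ n + 1`. [folklore] -/
theorem abs_mul_add_le {d η R n : ℝ} (hd : |d| ≤ 1) (hη : |η| ≤ 1) (hR : |R| ≤ n) :
    |d * η + R| ≤ n + 1 := by
  refine (abs_add_le _ _).trans ?_
  rw [abs_mul, add_comm n]; exact add_le_add (mul_le_one₀ hd (abs_nonneg _) hη) hR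

/-- A map of the coefficients within `1` of `b ↦ t·b` moves the linear part by at most the
length of the list (valid noise). [folklore] -/
theorem abs_lin_map_sub_le {g : ℤ → ℤ} {t : ℝ} (hg : ∀ b, |(g b : ℝ) - t * b| ≤ 1)
    (hε : Valid ε) (l : List ℤ) : |lin ε (l.map g) - t * lin ε l| ≤ l.length := by
  induction l generalizing ε with
  | nil => simp
  | cons b l ih =>
    rw [List.map_cons, lin_cons, lin_cons, List.length_cons, Nat.cast_succ]
    convert abs_mul_add_le (hg b) (hε 0) (ih hε.tail) using 2
    ring

/-- `|Σ_j a_j ε_j| ≤ Σ_j |a_j|` for valid noise. [cite: FigueiredoStolfi2004, §2] -/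
theorem abs_lin_le (hε : Valid ε) (l : List ℤ) : |lin ε l| ≤ absSum l := by
  induction l generalizing ε with
  | nil => simp [absSum]
  | cons b l ih =>
    rw [lin_cons, absSum_cons, Nat.cast_add, Nat.cast_natAbs, Int.cast_abs]
    refine (abs_add_le _ _).trans (add_le_add ?_ (ih hε.tail))
    rw [abs_mul]; exact mul_le_of_le_one_right (abs_nonneg _) (hε 0)

/-- The linear part of a zero-padded combination by an exactly linear `f`. [folklore] -/
theorem lin_zipWithPad {f : ℤ → ℤ → ℤ} {s t : ℝ} (hf : ∀ u v, (f u v : ℝ) = s * u + t * v)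
    (ε : ℕ → ℝ) (l₁ l₂ : List ℤ) :
    lin ε (zipWithPad f l₁ l₂) = s * lin ε l₁ + t * lin ε l₂ := by
  induction l₁ generalizing l₂ ε with
  | nil => rw [zipWithPad_nil, lin_map (t := t) (fun v => by rw [hf]; simp) ε l₂, lin_nil]; ring
  | cons b l₁ ih =>
    cases l₂ with
    | nil => rw [zipWithPad_cons_nil, lin_map (t := s) (fun u => by rw [hf]; simp) ε, lin_nil]; ring
    | cons d l₂ => rw [zipWithPad_cons_cons, lin_cons, lin_cons, lin_cons, ih, hf]; ring

/-- If `f u v` is within `1` of `s·u + t·v`, the linear part of `zipWithPad f l₁ l₂` is within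
`max |l₁| |l₂|` of `s·lin l₁ + t·lin l₂` (valid noise). [folklore] -/
theorem abs_lin_zipWithPad_sub_le {f : ℤ → ℤ → ℤ} {s t : ℝ}
    (hf : ∀ u v, |(f u v : ℝ) - (s * u + t * v)| ≤ 1) (hε : Valid ε) (l₁ l₂ : List ℤ) :
    |lin ε (zipWithPad f l₁ l₂) - (s * lin ε l₁ + t * lin ε l₂)| ≤ max l₁.length l₂.length := by
  induction l₁ generalizing l₂ ε with
  | nil =>
    rw [zipWithPad_nil, lin_nil, mul_zero, zero_add, List.length_nil, Nat.zero_max]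
    exact abs_lin_map_sub_le (fun v => by simpa using hf 0 v) hε l₂
  | cons b l₁ ih =>
    cases l₂ with
    | nil =>
      rw [zipWithPad_cons_nil, lin_nil, mul_zero, add_zero, List.length_nil, Nat.max_zero]
      exact abs_lin_map_sub_le (fun u => by simpa using hf u 0) hε _
    | cons d l₂ =>
      rw [zipWithPad_cons_cons, lin_cons, lin_cons, lin_cons, List.length_cons, List.length_cons,
        max_add_add_right, Nat.cast_succ]
      convert abs_mul_add_le (hf b d) (hε 0) (ih hε.tail l₂) using 2
      ring

/-- The linear part of the coefficient list of `var`: `w ε_j`. [folklore] -/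
theorem lin_replicate_append (ε : ℕ → ℝ) (w : ℤ) (j : ℕ) :
    lin ε (List.replicate j 0 ++ [w]) = w * ε j := by
  induction j generalizing ε with
  | zero => simp
  | succ j ih => rw [List.replicate_succ, List.cons_append, lin_cons, ih]; simp

/-- The floor of a rational is within `1` of it. [folklore] -/
theorem abs_floor_sub_le (q : ℚ) {t : ℝ} (ht : (q : ℝ) = t) : |((⌊q⌋ : ℤ) : ℝ) - t| ≤ 1 := by
  subst ht
  have h1 : ((⌊q⌋ : ℤ) : ℝ) ≤ (q : ℝ) := by exact_mod_cast Int.floor_le q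
  have h2 : (q : ℝ) < ((⌊q⌋ : ℤ) : ℝ) + 1 := by exact_mod_cast Int.lt_floor_add_one q
  rw [abs_le]; constructor <;> linarith

/-- Floor division by `S` is within `1` of the exact quotient. [folklore] -/
theorem abs_ediv_sub_le (S : ℕ) (p : ℤ) {t : ℝ} (ht : (p : ℝ) / S = t) :
    |((p / S : ℤ) : ℝ) - t| ≤ 1 := by
  rw [← Rat.floor_intCast_div_natCast]
  exact abs_floor_sub_le _ (by rw [← ht]; norm_cast)

/-- Ceiling division `⌈p/S⌉ = (p + S - 1)/S` on `ℕ` bounds the exact quotient. [folklore] -/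
theorem div_le_ceilDiv (hS : 0 < S) (p : ℕ) : (p : ℝ) / S ≤ (((p + S - 1) / S : ℕ) : ℝ) := by
  rw [div_le_iff₀ (by exact_mod_cast hS)]
  have h := Nat.lt_div_mul_add (a := p + S - 1) hS
  exact_mod_cast (show p ≤ (p + S - 1) / S * S by omega)

/-! ### Inclusion theorems -/

/-- [folklore] -/
theorem mem_const (hS : 0 < S) (c : ℤ) : mem S ε ((c : ℝ) / S) (const c) := by
  have hSr : (S : ℝ) ≠ 0 := by exact_mod_cast hS.ne'
  simp [mem, const, div_mul_cancel₀ _ hSr]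

/-- [folklore] -/
theorem mem_ofRat (S : ℕ) (q : ℚ) : mem S ε (q : ℝ) (ofRat S q) := by
  unfold mem
  rw [abs_sub_comm]
  simpa [ofRat] using abs_floor_sub_le (q * S) (t := (q : ℝ) * S) (by push_cast; ring)

/-- The box coordinate `(c + w ε_j)/S` lies in `var c w j`, exactly. [cite: FigueiredoStolfi2004, §2] -/
theorem mem_var (hS : 0 < S) (c w : ℤ) (j : ℕ) :
    mem S ε (((c : ℝ) + w * ε j) / S) (var c w j) := by
  have hSr : (S : ℝ) ≠ 0 := by exact_mod_cast hS.ne'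
  unfold mem; simp only [var, lin_replicate_append, div_mul_cancel₀ _ hSr]; simp

/-- [cite: FigueiredoStolfi2004, §3] -/
theorem mem_add (hx : mem S ε x F) (hy : mem S ε y G) : mem S ε (x + y) (add F G) := by
  unfold mem at hx hy ⊢
  simp only [add]
  rw [lin_zipWithPad (s := 1) (t := 1) (fun u v => by push_cast; ring)]
  push_cast
  have e : (x + y) * S - (F.c + G.c + (1 * lin ε F.a + 1 * lin ε G.a))
      = (x * S - (F.c + lin ε F.a)) + (y * S - (G.c + lin ε G.a)) := by ring
  exact e ▸ (abs_add_le _ _).trans (add_le_add hx hy)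

/-- [cite: FigueiredoStolfi2004, §3] -/
theorem mem_mulInt (k : ℤ) (hx : mem S ε x F) : mem S ε (k * x) (mulInt k F) := by
  unfold mem at hx ⊢
  simp only [mulInt]
  rw [lin_map (g := fun b => k * b) (t := (k : ℝ)) (fun b => by push_cast; ring)]
  push_cast [Nat.cast_natAbs, Int.cast_abs]
  rw [show (k : ℝ) * x * S - (k * F.c + k * lin ε F.a) = k * (x * S - (F.c + lin ε F.a)) by ring,
    abs_mul]
  exact mul_le_mul_of_nonneg_left hx (abs_nonneg _)

/-- [cite: FigueiredoStolfi2004, §3] -/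
theorem mem_neg (hx : mem S ε x F) : mem S ε (-x) (neg F) := by
  have h := mem_mulInt (-1) hx
  rwa [Int.cast_neg, Int.cast_one, neg_one_mul] at h

/-- [cite: FigueiredoStolfi2004, §3] -/
theorem mem_sub (hx : mem S ε x F) (hy : mem S ε y G) : mem S ε (x - y) (sub F G) := by
  rw [sub_eq_add_neg]
  exact mem_add hx (mem_neg hy)

/-- [cite: FigueiredoStolfi2004, §3] -/
theorem mem_addInt (hS : 0 < S) (k : ℤ) (hx : mem S ε x F) :
    mem S ε (x + k / S) (addInt k F) := by
  have hSr : (S : ℝ) ≠ 0 := by exact_mod_cast hS.ne'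
  unfold mem at hx ⊢
  simp only [addInt]
  rw [add_mul, div_mul_cancel₀ _ hSr, Int.cast_add]
  convert hx using 2
  ring

/-- `|x·S - c| ≤ rad F` on the form (valid noise). [cite: FigueiredoStolfi2004, §2] -/
theorem abs_sub_le_rad (hε : Valid ε) (hx : mem S ε x F) : |x * S - F.c| ≤ rad F := by
  unfold mem at hx
  simp only [rad, Nat.cast_add]
  have e : x * S - F.c = (x * S - (F.c + lin ε F.a)) + lin ε F.a := by ring
  rw [e, add_comm (absSum F.a : ℝ)]
  exact (abs_add_le _ _).trans (add_le_add hx (abs_lin_le hε _))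

/-- [cite: FigueiredoStolfi2004, §2] -/
theorem lo_le (hε : Valid ε) (hx : mem S ε x F) : (lo F : ℝ) ≤ x * S := by
  have h := (abs_le.1 (abs_sub_le_rad hε hx)).1
  simp only [lo, Int.cast_sub, Int.cast_natCast]; linarith

/-- [cite: FigueiredoStolfi2004, §2] -/
theorem le_hi (hε : Valid ε) (hx : mem S ε x F) : x * S ≤ (hi F : ℝ) := by
  have h := (abs_le.1 (abs_sub_le_rad hε hx)).2
  simp only [hi, Int.cast_add, Int.cast_natCast]; linarith

/-- **Inclusion theorem of the affine product.** [cite: FigueiredoStolfi2004, §3] -/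
theorem mem_mul (hS : 0 < S) (hε : Valid ε) (hx : mem S ε x F) (hy : mem S ε y G) :
    mem S ε (x * y) (mul S F G) := by
  simp only [mem, mul] at hx hy ⊢
  have hSr : (0 : ℝ) < S := by exact_mod_cast hS
  obtain ⟨e₁, he₁⟩ : ∃ e, x * S = F.c + lin ε F.a + e := ⟨x * S - (F.c + lin ε F.a), by ring⟩
  obtain ⟨e₂, he₂⟩ : ∃ e, y * S = G.c + lin ε G.a + e := ⟨y * S - (G.c + lin ε G.a), by ring⟩
  have hx' : |e₁| ≤ F.r := by convert hx using 2; linarith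
  have hy' : |e₂| ≤ G.r := by convert hy using 2; linarith
  set p : ℕ := F.c.natAbs * G.r + G.c.natAbs * F.r + rad F * rad G with hp
  have hN : |(F.c : ℝ) * e₂ + G.c * e₁ + (lin ε F.a + e₁) * (lin ε G.a + e₂)| ≤ p := by
    have h1 : |lin ε F.a + e₁| ≤ absSum F.a + F.r :=
      (abs_add_le _ _).trans (add_le_add (abs_lin_le hε _) hx')
    have h2 : |lin ε G.a + e₂| ≤ absSum G.a + G.r :=
      (abs_add_le _ _).trans (add_le_add (abs_lin_le hε _) hy')
    have hp' : (p : ℝ) = |(F.c : ℝ)| * G.r + |(G.c : ℝ)| * F.r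
        + (absSum F.a + F.r) * (absSum G.a + G.r) := by
      rw [hp]; push_cast [Nat.cast_natAbs, Int.cast_abs, rad]; ring
    rw [hp']; refine (abs_add_three _ _ _).trans ?_
    rw [abs_mul, abs_mul, abs_mul]; gcongr
  have hN' : |((F.c : ℝ) * e₂ + G.c * e₁ + (lin ε F.a + e₁) * (lin ε G.a + e₂)) / S| ≤ p / S := by
    rw [abs_div, abs_of_pos hSr]; exact div_le_div_of_nonneg_right hN hSr.le
  have hR : (p : ℝ) / S ≤ (((p + S - 1) / S : ℕ) : ℝ) := div_le_ceilDiv hS p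
  have hc := abs_ediv_sub_le S (F.c * G.c) rfl
  rw [abs_sub_comm] at hc; push_cast at hc
  have hlin : |(G.c : ℝ) / S * lin ε F.a + (F.c : ℝ) / S * lin ε G.a
      - lin ε (zipWithPad (fun u v => (F.c * v + G.c * u) / S) F.a G.a)|
      ≤ ((max F.a.length G.a.length : ℕ) : ℝ) := by
    rw [abs_sub_comm]
    refine abs_lin_zipWithPad_sub_le (fun u v => ?_) hε _ _
    have h := abs_ediv_sub_le S (F.c * v + G.c * u) rfl
    rwa [show ((F.c * v + G.c * u : ℤ) : ℝ) / S = (G.c : ℝ) / S * u + (F.c : ℝ) / S * v by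
      push_cast; ring] at h
  have e : x * y * S - (((F.c * G.c / S : ℤ) : ℝ)
      + lin ε (zipWithPad (fun u v => (F.c * v + G.c * u) / S) F.a G.a))
      = ((F.c : ℝ) * G.c / S - ((F.c * G.c / S : ℤ) : ℝ))
        + ((G.c : ℝ) / S * lin ε F.a + (F.c : ℝ) / S * lin ε G.a
            - lin ε (zipWithPad (fun u v => (F.c * v + G.c * u) / S) F.a G.a))
        + ((F.c : ℝ) * e₂ + G.c * e₁ + (lin ε F.a + e₁) * (lin ε G.a + e₂)) / S := by
    have h : x * y * S = (x * S) * (y * S) / S := by field_simp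
    rw [h, he₁, he₂]; ring
  rw [e, Nat.cast_add, Nat.cast_add, Nat.cast_one]
  refine (abs_add_three _ _ _).trans ?_
  linarith

/-- [cite: FigueiredoStolfi2004, §3] -/
theorem mem_sq (hS : 0 < S) (hε : Valid ε) (hx : mem S ε x F) : mem S ε (x ^ 2) (sq S F) := by
  rw [pow_two]; exact mem_mul hS hε hx hx

/-- `x(2 - x)` for `x = 1 + ε₀/2` at scale `2^10`: centre `1`, no linear term, radius `258/1024`
(kernel evaluation). -/
example : mul 1024 (var 1024 512 0) (sub (const 2048) (var 1024 512 0)) = ⟨1024, [0], 258⟩ := by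
  decide +kernel

end AForm

end Literature.Analysis.ValidatedNumerics
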